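import Literature.Computability.QuantumComplexity.CoreDescUniform
import HarnessLib

/-!
# Uniformity from an abstract gate list computed on codes

Topic `Literature/Computability/QuantumComplexity`; a generic packaging of the last step of the tree's
uniformity pipeline for structured Clifford+T families (`CoreDescAbstract.lean` … `CoreDescUniform.lean`,
written there for the AJL core family; Arora–Barak 2009, §6.2 and proof of Thm. 6.15: "output the
description gate by gate, keeping counters"). A length-indexed ORACLE-FREE family `F` whose circuits
abstract (`AJLCore.toAG`: symbol and `ℕ`-valued wires) to a list `circA n` that is computed in polynomial
time on codes (`CodeFP unE (rawE agE0) circA`, the typed `FP` algebra of `CodeFP.lean`), and whose ancilla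
count is computed in unary, is uniform (`QCircuitFamily.IsUniform`: `1ⁿ ↦ sigmaEncode ⟨n, ancillas n, circ n⟩`
in polynomial time):

* **`QCircuitFamily.isUniform_of_abstract`** — from `hfree`, `habs : ∀ n, (F.circ n).gates.map toAG = circA n`,
  `hanc : CodeFP unE unE F.ancillas`, `hA : CodeFP unE (rawE agE0) circA`;
* `QCircuitFamily.desc_codeFP_of_abstract` — the description itself on codes.

(Used by the sampler route for Regev 2009, Lemma 3.14 — the inner machine family of the classical wrap —
whose stages are abstracted one by one, e.g. `RegevSamplerEraseDesc.map_toAG_cnotLayer_par` / `eraseA_fp`.)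
No named fact is introduced.

HONEST FRAMING: the VALUE is a THEOREM (a kernel-checked generic lemma of KNOWN complexity theory) — NOT
summit progress; no trust base changes.

## References

* S. Arora, B. Barak, *Computational Complexity: A Modern Approach*, CUP 2009, §6.1 (descriptions of
  circuits), §6.2 and proof of Thm. 6.15 (uniformly generated families) [AroraBarak2009].
* E. Bernstein, U. Vazirani, *Quantum complexity theory*, SIAM J. Comput. 26 (1997), §8 (uniform quantum
  circuit families) [BernsteinVazirani1997].
* A. C.-C. Yao, *Quantum circuit complexity*, FOCS 1993 (uniform quantum circuit families) [Yao1993].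
-/

noncomputable section

namespace Literature.Computability.QuantumComplexity

open _root_.Computability Cryptography Complexity Complexity.CodeFP AJLCore

/-- **The description of an abstractly described family on codes**: if the circuits of an oracle-free family
abstract to `circA n`, computed on codes, and the ancilla count is computed in unary, then
`1ⁿ ↦ sigmaEncode ⟨n, ancillas n, circ n⟩` is computed on codes. [cite: AroraBarak2009, §6.2 and proof of Thm. 6.15] -/
theorem QCircuitFamily.desc_codeFP_of_abstract (F : QCircuitFamily cliffordT) (hfree : F.IsOracleFree)
    (circA : ℕ → List AG) (habs : ∀ n, (F.circ n).gates.map toAG = circA n) (hanc : CodeFP unE unE F.ancillas)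
    (hA : CodeFP unE (rawE agE0) circA) :
    CodeFP unE (QCircuit.sigmaEncode (G := cliffordT)) (fun n => (⟨n, F.ancillas n, F.circ n⟩ : Σ n m : ℕ, QCircuit cliffordT (n + m))) := by
  have hc : CodeFP unE (rawE agE) circA := ((map₀ agE_of_agE0).comp hA).congr fun _ => List.map_id _
  have h : CodeFP unE (pairE natE (pairE unE (rawE agE))) (fun n => (n, F.ancillas n, circA n)) := natOfUn.pair (hanc.pair hc)
  exact h.recodeOut fun n => by
    rw [QCircuit.sigmaEncode_eq, encode_eq_rawE _ (hfree n), habs]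
    rfl

/-- **Uniformity from an abstract gate list computed on codes.** [cite: AroraBarak2009, §6.2 and proof of Thm. 6.15]
[cite: BernsteinVazirani1997, §8] -/
theorem QCircuitFamily.isUniform_of_abstract (F : QCircuitFamily cliffordT) (hfree : F.IsOracleFree)
    (circA : ℕ → List AG) (habs : ∀ n, (F.circ n).gates.map toAG = circA n) (hanc : CodeFP unE unE F.ancillas)
    (hA : CodeFP unE (rawE agE0) circA) : F.IsUniform :=
  (QCircuitFamily.desc_codeFP_of_abstract F hfree circA habs hanc hA).polyTimeComputable

/-- The ancilla-free case: `ancillas = 0`. [cite: AroraBarak2009, §6.2] -/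
theorem QCircuitFamily.isUniform_of_abstract₀ (F : QCircuitFamily cliffordT) (hfree : F.IsOracleFree)
    (h0 : ∀ n, F.ancillas n = 0) (circA : ℕ → List AG) (habs : ∀ n, (F.circ n).gates.map toAG = circA n)
    (hA : CodeFP unE (rawE agE0) circA) : F.IsUniform :=
  QCircuitFamily.isUniform_of_abstract F hfree circA habs ((const unE 0).congr fun n => (h0 n).symm) hA

end Literature.Computability.QuantumComplexity

end
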